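import Summits.QuantumFields.YangMills.Theorems.PoincareLipschitzOrbitMinimiserLevelCoulomb
import Literature.MathematicalPhysics.QuantumFieldTheory.Balaban1983to89.BlockAveragingEMLLinearisedBackground
import Literature.MathematicalPhysics.QuantumFieldTheory.Balaban1983to89.B9TorusCalculus
import Literature.MathematicalPhysics.QuantumFieldTheory.Balaban1983to89.B10Eq27TorusAxialLog
import HarnessLib

/-!
# Line «poincare_lipschitz» on crux `HistoryTailL` (stmt-QuantumFields-19936), route crux `BlockLipschitzL` (stmt-QuantumFields-23533), K2 supplier plan,
# (R3)-COV — «COV-TOWER-DICT ∕ COV-DIV-BRIDGE»: THE DICTIONARY FROM THE RE-GAUGED TOWER'S LETTERS (`GaugeField P i SU(2)`, `pertVar`, `plaqHol`, the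
# orbit minimiser's `PBond`-indicator sums) TO THE LETTERS OF THE FROZEN (R3)-COV ROW ✓`PoincareLipschitzCovariantBridge.normSq_le_of_cov_curl_div_plaq_torus`
# (`B9Eq39Adjoint` over `torusT P i`: units background `U♯`, 1-form `A♯`, `curl`, `divB`, `plaqU`), AND THE `δ`-SLOT: at a box-ℓ²-ORBIT-MINIMISING pair the
# covariant divergence of the ratio chart is SECOND ORDER, `‖divB U♯ A♯ (x)‖ ≤ d·s²`, straight from the Kirchhoff law — no logarithm

Cell `ym3-torus` (YM ladder rung R3 = continuum SU(2) Yang–Mills on the three-torus — a RUNG, NOT the Clay problem: not d = 4, not infinite volume, not a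
mass gap); width seat `ym-ust-19936-w5` gen 11 (bus 2026-08-29T02:1xZ «COV-DIV-BRIDGE»; LEAD ym-ust-19936-w1 g7 02:02:59Z (3) «F6 DISPLAYED ROW := ★w5's
torus∕op-norm statement — ADOPTED», (4) F6 pen = w2 g11 whose displayed MASS ROW is fed by «F6-ROW» = COV-BRIDGE + COV-CURL-OF-RATIO + this file + ALIGN).
THEOREMS ONLY (def-free); `--supports stmt-QuantumFields-19936`.  Nothing here proves `hStab`, F6, a stub, `BlockLipschitzL`, `HistoryTailL` or a summit statement.

THE LETTERS.  For level-`i` fields `V W : GaugeField P i SU(2)` the row's background is `U♯ ν y := unitsField (toUField V) ⟨y, ν⟩ : M₂(ℂ)ˣ`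
(lit ✓`B10Eq27TorusAxialLog.unitsField`∕`toUField`), the 1-form is the RATIO CHART `A♯ ν y := pertVar V W ⟨y, ν⟩ = W_b·V_b⁻¹ − 1` (lit ✓`pertVar`, the tower's
own letter, ✓p686171∕✓p688053), the lattice is `torusT P i` (lit ✓`B9TorusCalculus`), and `R`, `curl`, `divB`, `plaqU` are ✓`B9Eq39Adjoint`'s.

* §1 (units) `val_unitsSU`, `val_inv_unitsSU` (`↑(U♯ b)⁻¹ = star ↑(V b)` — the row's `hU`), `norm_coe_su_eq_one`, ★`norm_R_unitsSU_le`∕`norm_R_inv_unitsSU_le`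
  (`‖R(U♯ b)^{±1} X‖ ≤ ‖X‖` — ✓`PoincareLipschitzCovariantCurlOfRatio.norm_curl_ratio_le`'s `hRμ`∕`hRν`).
* §2 (ratio chart) ★`val_eq_one_add_pertVar_mul` (`↑(W♯ b) = (1 + pertVar V W b)·↑(V♯ b)` — CURL-OF-RATIO's `h₁…h₄`), `one_add_pertVar_mul_star`
  (`(1 + A)(1 + A)* = 1`), `pertVar_sub_star` (`A − A* = 2A + AA*` EXACTLY).
* §3 (plaquettes) `val_plaqU_unitsSU_of_lt`∕`val_plaqU_unitsSU_of_gt` (`plaqU (torusT P i) U♯ μ ν x` = `plaqHol V ⟨x,μ,ν⟩` for `μ < ν`, = its `star` for `ν < μ`),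
  ★`norm_plaqU_sub_one_le_of_plaqHol` (every `dist1 (plaqHol V p) ≤ θ` at `p.src = x` ⇒ `‖↑(plaqU … μ ν x) − 1‖ ≤ θ` for all `ν ≠ μ` — the row's `hplaq`).
* §4 (divergence) `sum_ite_src_eq`∕`sum_ite_tgt_eq` (the orbit minimiser's `PBond`-indicator sums at an INTERIOR site are direction sums),
  ★★`divB_pertVar_eq_half` (under the Kirchhoff identity of ✓`PoincareLipschitzOrbitMinLevelCoulomb.kirchhoff_of_orbitMin_level`:
  `divB (torusT P i) U♯ A♯ x = ½(Σ_μ A_{(x,μ)}A_{(x,μ)}* − Σ_μ V_{b_μ}⁻¹(A_{b_μ}A_{b_μ}*)V_{b_μ})`, `b_μ = (x−e_μ, μ)` — EXACT),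
  ★★★`norm_divB_pertVar_le_of_orbitMin` (`W` box-ℓ²-orbit-minimising w.r.t. `V`, the `2d` bonds at `x` in the box, `‖pertVar V W‖ ≤ s` there ⇒
  `‖divB (torusT P i) U♯ A♯ x‖ ≤ d·s²` — the row's `hdiv`).
[folklore] (the letters are [Balaban1985BackgroundPropagators] (3.3), (3.8) pp.391–392; the Kirchhoff∕Landau-gauge reading is [Balaban1985Averaging] §3 (156)–(163) p.42's regime).
-/

set_option autoImplicit false

noncomputable section

open scoped BigOperators Matrix.Norms.L2Operator Matrix

namespace Summit.QuantumFields.YangMills.Theorems.PoincareLipschitzCovariantTowerDictionary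

open Literature.MathematicalPhysics.QuantumFieldTheory.Balaban1983to89
open B9Eq39Adjoint (R R_def covD covDstar curl divB plaqU)
open B9TorusCalculus (torusT torusT_apply torusT_symm_apply)
open B10Eq27TorusAxialLog (unitsField toUField val_unitsField val_suIncl)
open BlockAveragingEMLLinearisedBackground (pertVar)
open LatticeFieldCalculus (shiftEquiv)
open Summit.QuantumFields.YangMills.Theorems.PoincareLipschitzOrbitMinLevelCoulomb (kirchhoff_of_orbitMin_level)
open Summit.QuantumFields.YangMills.Theorems.PoincareLipschitzOrbitMinLinearCoulomb (norm_conj_le)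

variable {P : Params} {i : ℕ}

/-! ## §1 The units background `U♯ = unitsField (toUField V)` -/

/-- The inverse in `SU(2)` is the conjugate transpose (coercion). [folklore] -/
theorem coe_inv_su (g : Matrix.specialUnitaryGroup (Fin 2) ℂ) :
    (((g⁻¹ : Matrix.specialUnitaryGroup (Fin 2) ℂ)) : Matrix (Fin 2) (Fin 2) ℂ) = star ((g : Matrix.specialUnitaryGroup (Fin 2) ℂ) : Matrix (Fin 2) (Fin 2) ℂ) := rfl

/-- `↑(U♯ b) = ↑(V b)`. [folklore] [cite: Balaban1985Averaging, (19) p.21] -/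
theorem val_unitsSU (V : GaugeField P i (Matrix.specialUnitaryGroup (Fin 2) ℂ)) (b : PBond P i) :
    ((unitsField (toUField V) b : (Matrix (Fin 2) (Fin 2) ℂ)ˣ) : Matrix (Fin 2) (Fin 2) ℂ) = ((V b : Matrix.specialUnitaryGroup (Fin 2) ℂ) : Matrix (Fin 2) (Fin 2) ℂ) := by
  simp [unitsField, toUField]

/-- `↑(U♯ b)⁻¹ = (↑(V b))*` — the `hU` hypothesis of the frozen row. [folklore] [cite: Balaban1985Averaging, (19) p.21] -/
theorem val_inv_unitsSU (V : GaugeField P i (Matrix.specialUnitaryGroup (Fin 2) ℂ)) (b : PBond P i) :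
    ((((unitsField (toUField V) b)⁻¹ : (Matrix (Fin 2) (Fin 2) ℂ)ˣ)) : Matrix (Fin 2) (Fin 2) ℂ) = star ((V b : Matrix.specialUnitaryGroup (Fin 2) ℂ) : Matrix (Fin 2) (Fin 2) ℂ) := by
  rw [← val_unitsSU V b]
  simp [unitsField, toUField]

/-- `‖↑g‖ = 1` for `g ∈ SU(2)` (operator norm). [folklore] -/
theorem norm_coe_su_eq_one (g : Matrix.specialUnitaryGroup (Fin 2) ℂ) : ‖((g : Matrix.specialUnitaryGroup (Fin 2) ℂ) : Matrix (Fin 2) (Fin 2) ℂ)‖ = 1 :=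
  CStarRing.norm_of_mem_unitary (Matrix.mem_specialUnitaryGroup_iff.1 g.2).1

/-- ★ The transports `R(U♯ b)X = V_b X V_b⁻¹` do not increase the operator norm (CURL-OF-RATIO's `hRμ`∕`hRν`). [folklore] [cite: Balaban1985Averaging, (19) p.21] -/
theorem norm_R_unitsSU_le (V : GaugeField P i (Matrix.specialUnitaryGroup (Fin 2) ℂ)) (b : PBond P i) (X : Matrix (Fin 2) (Fin 2) ℂ) :
    ‖R (unitsField (toUField V) b) X‖ ≤ ‖X‖ := by
  rw [R_def, val_inv_unitsSU, val_unitsSU]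
  calc _ ≤ ‖((V b : Matrix.specialUnitaryGroup (Fin 2) ℂ) : Matrix (Fin 2) (Fin 2) ℂ)‖ * ‖X‖ * ‖star ((V b : Matrix.specialUnitaryGroup (Fin 2) ℂ) : Matrix (Fin 2) (Fin 2) ℂ)‖ :=
        (norm_mul_le _ _).trans (mul_le_mul_of_nonneg_right (norm_mul_le _ _) (norm_nonneg _))
    _ = ‖X‖ := by rw [norm_star, norm_coe_su_eq_one, one_mul, mul_one]

/-- ★ The inverse transports `R(U♯ b)⁻¹X = V_b⁻¹ X V_b` do not increase the operator norm. [folklore] [cite: Balaban1985Averaging, (19) p.21] -/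
theorem norm_R_inv_unitsSU_le (V : GaugeField P i (Matrix.specialUnitaryGroup (Fin 2) ℂ)) (b : PBond P i) (X : Matrix (Fin 2) (Fin 2) ℂ) :
    ‖R (unitsField (toUField V) b)⁻¹ X‖ ≤ ‖X‖ := by
  rw [R_def, inv_inv, val_inv_unitsSU, val_unitsSU]
  calc _ ≤ ‖star ((V b : Matrix.specialUnitaryGroup (Fin 2) ℂ) : Matrix (Fin 2) (Fin 2) ℂ)‖ * ‖X‖ * ‖((V b : Matrix.specialUnitaryGroup (Fin 2) ℂ) : Matrix (Fin 2) (Fin 2) ℂ)‖ :=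
        (norm_mul_le _ _).trans (mul_le_mul_of_nonneg_right (norm_mul_le _ _) (norm_nonneg _))
    _ = ‖X‖ := by rw [norm_star, norm_coe_su_eq_one, one_mul, mul_one]

/-! ## §2 The ratio chart `A = pertVar V W = W·V⁻¹ − 1` -/

/-- ★ `↑(W♯ b) = (1 + pertVar V W b)·↑(V♯ b)` — the hypotheses `h₁…h₄` of ✓`norm_curl_ratio_le`. [cite: Balaban1985Variational, (15) p.280] -/
theorem val_eq_one_add_pertVar_mul (V W : GaugeField P i (Matrix.specialUnitaryGroup (Fin 2) ℂ)) (b : PBond P i) :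
    ((unitsField (toUField W) b : (Matrix (Fin 2) (Fin 2) ℂ)ˣ) : Matrix (Fin 2) (Fin 2) ℂ) =
      (1 + pertVar V W b) * ((unitsField (toUField V) b : (Matrix (Fin 2) (Fin 2) ℂ)ˣ) : Matrix (Fin 2) (Fin 2) ℂ) := by
  rw [val_unitsSU, val_unitsSU, pertVar, add_sub_cancel, Submonoid.coe_mul, Matrix.mul_assoc, ← Submonoid.coe_mul, inv_mul_cancel]
  simp

/-- `(1 + A_b)(1 + A_b)* = 1` (`1 + A_b = W_bV_b⁻¹ ∈ SU(2)`). [folklore] -/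
theorem one_add_pertVar_mul_star (V W : GaugeField P i (Matrix.specialUnitaryGroup (Fin 2) ℂ)) (b : PBond P i) :
    (1 + pertVar V W b) * star (1 + pertVar V W b) = 1 := by
  rw [pertVar, add_sub_cancel]
  exact (Matrix.mem_specialUnitaryGroup_iff.1 (W b * (V b)⁻¹).2).1.2

/-- `A − A* = 2A + AA*` EXACTLY for the ratio chart (from `(1 + A)(1 + A)* = 1`). [folklore] -/
theorem pertVar_sub_star (V W : GaugeField P i (Matrix.specialUnitaryGroup (Fin 2) ℂ)) (b : PBond P i) :
    pertVar V W b - star (pertVar V W b) = 2 • pertVar V W b + pertVar V W b * star (pertVar V W b) := by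
  set A := pertVar V W b with hA
  have h := one_add_pertVar_mul_star V W b
  rw [← hA, star_add, star_one] at h
  have h0 : star A + A + A * star A = 0 := by
    have e : (1 + A) * (1 + star A) = 1 + (star A + A + A * star A) := by noncomm_ring
    rw [e] at h
    exact add_eq_left.mp h
  rw [← sub_eq_zero]
  have e : A - star A - (2 • A + A * star A) = -(star A + A + A * star A) := by rw [two_smul]; abel
  rw [e, h0, neg_zero]

/-! ## §3 The plaquette letters -/

/-- `plaqU (torusT P i) U♯ μ ν x = plaqHol V ⟨x, μ, ν⟩` (as matrices) for `μ < ν`. [cite: Balaban1985Averaging, (9) p.19] -/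
theorem val_plaqU_unitsSU_of_lt (V : GaugeField P i (Matrix.specialUnitaryGroup (Fin 2) ℂ)) {μ ν : Fin P.d} (h : μ < ν) (x : Site P i) :
    ((plaqU (torusT P i) (fun κ y => unitsField (toUField V) ⟨y, κ⟩) μ ν x : (Matrix (Fin 2) (Fin 2) ℂ)ˣ) : Matrix (Fin 2) (Fin 2) ℂ) =
      ((GaugeField.plaqHol V ⟨x, μ, ν, h⟩ : Matrix.specialUnitaryGroup (Fin 2) ℂ) : Matrix (Fin 2) (Fin 2) ℂ) := by
  simp only [plaqU, GaugeField.plaqHol, torusT_apply, Units.val_mul, val_unitsSU, val_inv_unitsSU, Submonoid.coe_mul, coe_inv_su]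

/-- `plaqU (torusT P i) U♯ μ ν x = (plaqHol V ⟨x, ν, μ⟩)*` (as matrices) for `ν < μ` (the reversed orientation). [cite: Balaban1985Averaging, (9) p.19] -/
theorem val_plaqU_unitsSU_of_gt (V : GaugeField P i (Matrix.specialUnitaryGroup (Fin 2) ℂ)) {μ ν : Fin P.d} (h : ν < μ) (x : Site P i) :
    ((plaqU (torusT P i) (fun κ y => unitsField (toUField V) ⟨y, κ⟩) μ ν x : (Matrix (Fin 2) (Fin 2) ℂ)ˣ) : Matrix (Fin 2) (Fin 2) ℂ) =
      star ((GaugeField.plaqHol V ⟨x, ν, μ, h⟩ : Matrix.specialUnitaryGroup (Fin 2) ℂ) : Matrix (Fin 2) (Fin 2) ℂ) := by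
  simp only [plaqU, GaugeField.plaqHol, torusT_apply, Units.val_mul, val_unitsSU, val_inv_unitsSU, Submonoid.coe_mul, coe_inv_su, star_mul, star_star,
    Matrix.mul_assoc]

/-- ★ **THE ROW's `hplaq` FROM THE TOWER's PLAQUETTE WINDOW**: if every plaquette `p` with `p.src = x` has `dist1 (plaqHol V p) ≤ θ`, then for all `ν ≠ μ`,
`‖↑(plaqU (torusT P i) U♯ μ ν x) − 1‖ ≤ θ` (`dist1 = ‖· − 1‖` on `SU(2)`, `‖g* − 1‖ = ‖g − 1‖`). [cite: Balaban1985Averaging, (19) p.21] -/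
theorem norm_plaqU_sub_one_le_of_plaqHol (V : GaugeField P i (Matrix.specialUnitaryGroup (Fin 2) ℂ)) (x : Site P i) {θ : ℝ}
    (hθ : ∀ p : Plaq P i, p.src = x → dist1 (GaugeField.plaqHol V p) ≤ θ) {μ ν : Fin P.d} (hne : ν ≠ μ) :
    ‖((plaqU (torusT P i) (fun κ y => unitsField (toUField V) ⟨y, κ⟩) μ ν x : (Matrix (Fin 2) (Fin 2) ℂ)ˣ) : Matrix (Fin 2) (Fin 2) ℂ) - 1‖ ≤ θ := by
  rcases lt_or_gt_of_ne hne with h | h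
  · -- `ν < μ`: the reversed orientation
    rw [val_plaqU_unitsSU_of_gt V h x, ← star_one (R := Matrix (Fin 2) (Fin 2) ℂ), ← star_sub, norm_star]
    exact hθ ⟨x, ν, μ, h⟩ rfl
  · rw [val_plaqU_unitsSU_of_lt V h x]
    exact hθ ⟨x, μ, ν, h⟩ rfl

/-! ## §4 The covariant divergence of the ratio chart at an orbit minimiser -/

/-- At an interior site the `PBond`-indicator sum over `b.src = x` is the direction sum. [folklore] -/
theorem sum_ite_src_eq {M : Type*} [AddCommMonoid M] (box : PBond P i → Prop) [DecidablePred box] (f : PBond P i → M) (x : Site P i)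
    (hbox : ∀ μ : Fin P.d, box ⟨x, μ⟩) :
    (∑ b : PBond P i, if box b ∧ b.src = x then f b else 0) = ∑ μ : Fin P.d, f ⟨x, μ⟩ := by
  classical
  rw [← Equiv.sum_comp (LatticeFieldCalculus.bondEquiv (P := P) (j := i)), Fintype.sum_prod_type]
  simp only [LatticeFieldCalculus.bondEquiv, Equiv.coe_fn_mk]
  rw [Finset.sum_eq_single x (fun y _ hy => Finset.sum_eq_zero fun μ _ => if_neg fun hh => hy hh.2) (fun hh => absurd (Finset.mem_univ x) hh)]
  exact Finset.sum_congr rfl fun μ _ => if_pos ⟨hbox μ, rfl⟩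

/-- At an interior site the `PBond`-indicator sum over `b.tgt = x` is the direction sum over the bonds `(x − e_μ, μ)`. [folklore] -/
theorem sum_ite_tgt_eq {M : Type*} [AddCommMonoid M] (box : PBond P i → Prop) [DecidablePred box] (f : PBond P i → M) (x : Site P i)
    (hbox : ∀ μ : Fin P.d, box ⟨x.unshift μ, μ⟩) :
    (∑ b : PBond P i, if box b ∧ b.tgt = x then f b else 0) = ∑ μ : Fin P.d, f ⟨x.unshift μ, μ⟩ := by
  classical
  rw [← Equiv.sum_comp (LatticeFieldCalculus.bondEquiv (P := P) (j := i)), Fintype.sum_prod_type]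
  simp only [LatticeFieldCalculus.bondEquiv, Equiv.coe_fn_mk]
  rw [Finset.sum_comm]
  refine Finset.sum_congr rfl fun μ _ => ?_
  have hkey : ∀ y : Site P i, (PBond.tgt (⟨y, μ⟩ : PBond P i) = x) ↔ y = x.unshift μ := by
    intro y
    show y.shift μ = x ↔ y = x.unshift μ
    constructor
    · intro hy
      have := (shiftEquiv (P := P) (j := i) μ).symm_apply_apply y
      rw [← hy]; exact this.symm
    · intro hy
      rw [hy]; exact (shiftEquiv (P := P) (j := i) μ).apply_symm_apply x
  rw [Finset.sum_eq_single (x.unshift μ) (fun y _ hy => if_neg fun hh => hy ((hkey y).1 hh.2)) (fun hh => absurd (Finset.mem_univ _) hh)]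
  exact if_pos ⟨hbox μ, (hkey _).2 rfl⟩

/-- ★★ **THE COVARIANT DIVERGENCE OF THE RATIO CHART FROM KIRCHHOFF, EXACTLY**: if the Kirchhoff identity of ✓`kirchhoff_of_orbitMin_level` holds at an
interior site `x` (its `2d` bonds in the box), then with `A = pertVar V W`, `b_μ = (x − e_μ, μ)`:
`divB (torusT P i) U♯ A♯ x = ½·(Σ_μ A_{(x,μ)}A_{(x,μ)}* − Σ_μ V_{b_μ}*(A_{b_μ}A_{b_μ}*)V_{b_μ})` (`W − W⁻¹ = A − A* = 2A + AA*` bondwise). [folklore]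
[cite: Balaban1985BackgroundPropagators, (3.8) p.392] -/
theorem divB_pertVar_eq_half (box : PBond P i → Prop) [DecidablePred box] (V W : GaugeField P i (Matrix.specialUnitaryGroup (Fin 2) ℂ)) (x : Site P i)
    (hbox : ∀ μ : Fin P.d, box ⟨x, μ⟩ ∧ box ⟨x.unshift μ, μ⟩)
    (hK : (∑ b : PBond P i, if box b ∧ b.src = x then
        ((((W b : Matrix.specialUnitaryGroup (Fin 2) ℂ) : Matrix (Fin 2) (Fin 2) ℂ) * (((V b)⁻¹ : Matrix.specialUnitaryGroup (Fin 2) ℂ) : Matrix (Fin 2) (Fin 2) ℂ)) -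
          (((V b : Matrix.specialUnitaryGroup (Fin 2) ℂ) : Matrix (Fin 2) (Fin 2) ℂ) * (((W b)⁻¹ : Matrix.specialUnitaryGroup (Fin 2) ℂ) : Matrix (Fin 2) (Fin 2) ℂ))) else 0) =
      ∑ b : PBond P i, if box b ∧ b.tgt = x then
        (((((V b)⁻¹ : Matrix.specialUnitaryGroup (Fin 2) ℂ) : Matrix (Fin 2) (Fin 2) ℂ) * ((W b : Matrix.specialUnitaryGroup (Fin 2) ℂ) : Matrix (Fin 2) (Fin 2) ℂ)) -
          ((((W b)⁻¹ : Matrix.specialUnitaryGroup (Fin 2) ℂ) : Matrix (Fin 2) (Fin 2) ℂ) * ((V b : Matrix.specialUnitaryGroup (Fin 2) ℂ) : Matrix (Fin 2) (Fin 2) ℂ))) else 0) :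
    divB (torusT P i) (fun κ y => unitsField (toUField V) ⟨y, κ⟩) (fun κ y => pertVar V W ⟨y, κ⟩) x =
      (2 : ℂ)⁻¹ • ((∑ μ : Fin P.d, pertVar V W ⟨x, μ⟩ * star (pertVar V W ⟨x, μ⟩)) -
        ∑ μ : Fin P.d, star ((V ⟨x.unshift μ, μ⟩ : Matrix.specialUnitaryGroup (Fin 2) ℂ) : Matrix (Fin 2) (Fin 2) ℂ) *
          (pertVar V W ⟨x.unshift μ, μ⟩ * star (pertVar V W ⟨x.unshift μ, μ⟩)) * ((V ⟨x.unshift μ, μ⟩ : Matrix.specialUnitaryGroup (Fin 2) ℂ) : Matrix (Fin 2) (Fin 2) ℂ)) := by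
  classical
  -- abbreviations
  set A : PBond P i → Matrix (Fin 2) (Fin 2) ℂ := fun b => pertVar V W b with hA
  set Vc : PBond P i → Matrix (Fin 2) (Fin 2) ℂ := fun b => ((V b : Matrix.specialUnitaryGroup (Fin 2) ℂ) : Matrix (Fin 2) (Fin 2) ℂ) with hVc
  -- bond letters: `W V⁻¹ = 1 + A`, `V W⁻¹ = 1 + A*`, `V⁻¹ W = V*(1 + A)V`, `W⁻¹ V = V*(1 + A*)V`
  have hVV : ∀ b, star (Vc b) * Vc b = 1 := fun b => (Matrix.mem_specialUnitaryGroup_iff.1 (V b).2).1.1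
  have hWV : ∀ b, ((W b : Matrix.specialUnitaryGroup (Fin 2) ℂ) : Matrix (Fin 2) (Fin 2) ℂ) * (((V b)⁻¹ : Matrix.specialUnitaryGroup (Fin 2) ℂ) : Matrix (Fin 2) (Fin 2) ℂ) =
      1 + A b := by
    intro b; rw [hA]; simp only [pertVar, Submonoid.coe_mul, add_sub_cancel]
  have hVW : ∀ b, ((V b : Matrix.specialUnitaryGroup (Fin 2) ℂ) : Matrix (Fin 2) (Fin 2) ℂ) * (((W b)⁻¹ : Matrix.specialUnitaryGroup (Fin 2) ℂ) : Matrix (Fin 2) (Fin 2) ℂ) =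
      1 + star (A b) := by
    intro b
    have : ((V b : Matrix.specialUnitaryGroup (Fin 2) ℂ) : Matrix (Fin 2) (Fin 2) ℂ) * (((W b)⁻¹ : Matrix.specialUnitaryGroup (Fin 2) ℂ) : Matrix (Fin 2) (Fin 2) ℂ) =
        star (((W b : Matrix.specialUnitaryGroup (Fin 2) ℂ) : Matrix (Fin 2) (Fin 2) ℂ) * (((V b)⁻¹ : Matrix.specialUnitaryGroup (Fin 2) ℂ) : Matrix (Fin 2) (Fin 2) ℂ)) := by
      rw [star_mul, coe_inv_su, coe_inv_su, star_star]
    rw [this, hWV, star_add, star_one]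
  have hViW : ∀ b, (((V b)⁻¹ : Matrix.specialUnitaryGroup (Fin 2) ℂ) : Matrix (Fin 2) (Fin 2) ℂ) * ((W b : Matrix.specialUnitaryGroup (Fin 2) ℂ) : Matrix (Fin 2) (Fin 2) ℂ) =
      star (Vc b) * (1 + A b) * Vc b := by
    intro b
    rw [← hWV, Matrix.mul_assoc, Matrix.mul_assoc]
    show star (Vc b) * _ = star (Vc b) * (_ * (star (Vc b) * Vc b))
    rw [hVV, Matrix.mul_one]
  have hWiV : ∀ b, (((W b)⁻¹ : Matrix.specialUnitaryGroup (Fin 2) ℂ) : Matrix (Fin 2) (Fin 2) ℂ) * ((V b : Matrix.specialUnitaryGroup (Fin 2) ℂ) : Matrix (Fin 2) (Fin 2) ℂ) =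
      star (Vc b) * (1 + star (A b)) * Vc b := by
    intro b
    have e1 : (((W b)⁻¹ : Matrix.specialUnitaryGroup (Fin 2) ℂ) : Matrix (Fin 2) (Fin 2) ℂ) * ((V b : Matrix.specialUnitaryGroup (Fin 2) ℂ) : Matrix (Fin 2) (Fin 2) ℂ) =
        star ((((V b)⁻¹ : Matrix.specialUnitaryGroup (Fin 2) ℂ) : Matrix (Fin 2) (Fin 2) ℂ) * ((W b : Matrix.specialUnitaryGroup (Fin 2) ℂ) : Matrix (Fin 2) (Fin 2) ℂ)) := by
      rw [star_mul, coe_inv_su, coe_inv_su, star_star]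
    rw [e1, hViW, star_mul, star_mul, star_add, star_one, star_star, Matrix.mul_assoc]
  -- Kirchhoff in direction sums
  rw [sum_ite_src_eq box _ x (fun μ => (hbox μ).1), sum_ite_tgt_eq box _ x (fun μ => (hbox μ).2)] at hK
  simp only [hWV, hVW, hViW, hWiV] at hK
  -- `(1 + A) − (1 + A*) = 2A + AA*` and its conjugated twin
  have hL : ∀ b, (1 + A b) - (1 + star (A b)) = (2 : ℂ) • A b + A b * star (A b) := by
    intro b
    rw [add_sub_add_left_eq_sub]
    have := pertVar_sub_star V W b
    rw [two_smul] at this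
    rw [hA]; simp only at this ⊢
    rw [this, two_smul]
  have hR' : ∀ b, star (Vc b) * (1 + A b) * Vc b - star (Vc b) * (1 + star (A b)) * Vc b = star (Vc b) * ((2 : ℂ) • A b + A b * star (A b)) * Vc b := by
    intro b; rw [← hL]; noncomm_ring
  simp only [hL, hR'] at hK
  -- the divergence in these letters
  have hdiv : divB (torusT P i) (fun κ y => unitsField (toUField V) ⟨y, κ⟩) (fun κ y => pertVar V W ⟨y, κ⟩) x =
      (∑ μ : Fin P.d, star (Vc ⟨x.unshift μ, μ⟩) * A ⟨x.unshift μ, μ⟩ * Vc ⟨x.unshift μ, μ⟩) - ∑ μ : Fin P.d, A ⟨x, μ⟩ := by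
    simp only [divB, covDstar, R_def, torusT_symm_apply, inv_inv, val_inv_unitsSU, val_unitsSU, Finset.sum_sub_distrib]
    rfl
  rw [hdiv]
  -- solve for the divergence from the Kirchhoff identity
  have hK' : (2 : ℂ) • (∑ μ : Fin P.d, A ⟨x, μ⟩) + ∑ μ : Fin P.d, A ⟨x, μ⟩ * star (A ⟨x, μ⟩) =
      (2 : ℂ) • (∑ μ : Fin P.d, star (Vc ⟨x.unshift μ, μ⟩) * A ⟨x.unshift μ, μ⟩ * Vc ⟨x.unshift μ, μ⟩) +
        ∑ μ : Fin P.d, star (Vc ⟨x.unshift μ, μ⟩) * (A ⟨x.unshift μ, μ⟩ * star (A ⟨x.unshift μ, μ⟩)) * Vc ⟨x.unshift μ, μ⟩ := by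
    rw [Finset.smul_sum, Finset.smul_sum, ← Finset.sum_add_distrib, ← Finset.sum_add_distrib]
    convert hK using 2 with μ _ μ _
    · noncomm_ring
  have h2 : (2 : ℂ) ≠ 0 := two_ne_zero
  apply smul_right_injective (Matrix (Fin 2) (Fin 2) ℂ) h2
  simp only [smul_sub, smul_smul, mul_inv_cancel₀ h2, one_smul]
  rw [sub_eq_sub_iff_add_eq_add]
  calc (2 : ℂ) • ∑ μ : Fin P.d, star (Vc ⟨x.unshift μ, μ⟩) * A ⟨x.unshift μ, μ⟩ * Vc ⟨x.unshift μ, μ⟩ +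
        ∑ μ : Fin P.d, star (Vc ⟨x.unshift μ, μ⟩) * (A ⟨x.unshift μ, μ⟩ * star (A ⟨x.unshift μ, μ⟩)) * Vc ⟨x.unshift μ, μ⟩
      = (2 : ℂ) • (∑ μ : Fin P.d, A ⟨x, μ⟩) + ∑ μ : Fin P.d, A ⟨x, μ⟩ * star (A ⟨x, μ⟩) := hK'.symm
    _ = _ := by abel

/-- ★★★ **THE `δ`-SLOT OF THE FROZEN ROW FROM THE ORBIT MINIMISER**: if `W` is a box-ℓ²-closest point of its level-`i` gauge orbit to `V` (the `hmin` of
✓`kirchhoff_of_orbitMin_level` ∕ w2 g11's displayed MASS ROW), the `2d` bonds at `x` lie in the box, and `‖pertVar V W‖ ≤ s` on them, then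
`‖divB (torusT P i) U♯ A♯ x‖ ≤ d·s²` — the covariant divergence of the ratio chart is SECOND ORDER at a minimiser (Kirchhoff + `A − A* = 2A + AA*`; no logarithm).
[folklore] [cite: Balaban1985Averaging, (156)-(163) p.42] -/
theorem norm_divB_pertVar_le_of_orbitMin (box : PBond P i → Prop) [DecidablePred box] (V W : GaugeField P i (Matrix.specialUnitaryGroup (Fin 2) ℂ))
    (hmin : ∀ k : GaugeTransf P i (Matrix.specialUnitaryGroup (Fin 2) ℂ),
      (∑ b : PBond P i, if box b then dist1 (V b * (W b)⁻¹) ^ 2 else 0) ≤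
        ∑ b : PBond P i, if box b then dist1 (V b * (GaugeField.gaugeAct k W b)⁻¹) ^ 2 else 0)
    (x : Site P i) (hbox : ∀ μ : Fin P.d, box ⟨x, μ⟩ ∧ box ⟨x.unshift μ, μ⟩) {s : ℝ} (hs0 : 0 ≤ s)
    (hs : ∀ μ : Fin P.d, ‖pertVar V W ⟨x, μ⟩‖ ≤ s ∧ ‖pertVar V W ⟨x.unshift μ, μ⟩‖ ≤ s) :
    ‖divB (torusT P i) (fun κ y => unitsField (toUField V) ⟨y, κ⟩) (fun κ y => pertVar V W ⟨y, κ⟩) x‖ ≤ (P.d : ℝ) * s ^ 2 := by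
  classical
  rw [divB_pertVar_eq_half box V W x hbox (kirchhoff_of_orbitMin_level box V W hmin x)]
  have hAA : ∀ b : PBond P i, ‖pertVar V W b‖ ≤ s → ‖pertVar V W b * star (pertVar V W b)‖ ≤ s ^ 2 := by
    intro b hb
    calc _ ≤ ‖pertVar V W b‖ * ‖star (pertVar V W b)‖ := norm_mul_le _ _
      _ ≤ s * s := by rw [norm_star]; exact mul_le_mul hb hb (norm_nonneg _) hs0
      _ = s ^ 2 := (sq s).symm
  have h1 : ‖∑ μ : Fin P.d, pertVar V W ⟨x, μ⟩ * star (pertVar V W ⟨x, μ⟩)‖ ≤ (P.d : ℝ) * s ^ 2 := by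
    calc _ ≤ ∑ μ : Fin P.d, ‖pertVar V W ⟨x, μ⟩ * star (pertVar V W ⟨x, μ⟩)‖ := norm_sum_le _ _
      _ ≤ ∑ _μ : Fin P.d, s ^ 2 := Finset.sum_le_sum fun μ _ => hAA _ (hs μ).1
      _ = (P.d : ℝ) * s ^ 2 := by rw [Finset.sum_const, Finset.card_univ, Fintype.card_fin, nsmul_eq_mul]
  have h2 : ‖∑ μ : Fin P.d, star ((V ⟨x.unshift μ, μ⟩ : Matrix.specialUnitaryGroup (Fin 2) ℂ) : Matrix (Fin 2) (Fin 2) ℂ) *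
      (pertVar V W ⟨x.unshift μ, μ⟩ * star (pertVar V W ⟨x.unshift μ, μ⟩)) * ((V ⟨x.unshift μ, μ⟩ : Matrix.specialUnitaryGroup (Fin 2) ℂ) : Matrix (Fin 2) (Fin 2) ℂ)‖ ≤
      (P.d : ℝ) * s ^ 2 := by
    calc _ ≤ ∑ μ : Fin P.d, ‖star ((V ⟨x.unshift μ, μ⟩ : Matrix.specialUnitaryGroup (Fin 2) ℂ) : Matrix (Fin 2) (Fin 2) ℂ) *
          (pertVar V W ⟨x.unshift μ, μ⟩ * star (pertVar V W ⟨x.unshift μ, μ⟩)) * ((V ⟨x.unshift μ, μ⟩ : Matrix.specialUnitaryGroup (Fin 2) ℂ) : Matrix (Fin 2) (Fin 2) ℂ)‖ :=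
          norm_sum_le _ _
      _ ≤ ∑ _μ : Fin P.d, s ^ 2 := Finset.sum_le_sum fun μ _ => (norm_conj_le (V ⟨x.unshift μ, μ⟩) _).trans (hAA _ (hs μ).2)
      _ = (P.d : ℝ) * s ^ 2 := by rw [Finset.sum_const, Finset.card_univ, Fintype.card_fin, nsmul_eq_mul]
  calc _ ≤ ‖(2 : ℂ)⁻¹‖ * (‖∑ μ : Fin P.d, pertVar V W ⟨x, μ⟩ * star (pertVar V W ⟨x, μ⟩)‖ +
        ‖∑ μ : Fin P.d, star ((V ⟨x.unshift μ, μ⟩ : Matrix.specialUnitaryGroup (Fin 2) ℂ) : Matrix (Fin 2) (Fin 2) ℂ) *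
          (pertVar V W ⟨x.unshift μ, μ⟩ * star (pertVar V W ⟨x.unshift μ, μ⟩)) * ((V ⟨x.unshift μ, μ⟩ : Matrix.specialUnitaryGroup (Fin 2) ℂ) : Matrix (Fin 2) (Fin 2) ℂ)‖) :=
        (norm_smul_le _ _).trans (mul_le_mul_of_nonneg_left (norm_sub_le _ _) (norm_nonneg _))
    _ ≤ (1 / 2) * ((P.d : ℝ) * s ^ 2 + (P.d : ℝ) * s ^ 2) := by
        have : ‖(2 : ℂ)⁻¹‖ = 1 / 2 := by rw [norm_inv, Complex.norm_two, one_div]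
        rw [this]
        exact mul_le_mul_of_nonneg_left (add_le_add h1 h2) (by norm_num)
    _ = (P.d : ℝ) * s ^ 2 := by ring

end Summit.QuantumFields.YangMills.Theorems.PoincareLipschitzCovariantTowerDictionary

end
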